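import Literature.NumberTheory.Rogawski1990.LocalTransferSecondClassDescentCM                      -- ★ p842329 A-p17 (g21): `exists_isLocallyConstant_descent_secondClass` = `hD′` at `C′ := Z(ε′)`; ★ p842198 `compactSpace_centralizer_of_frame_of_anisotropic`
import Literature.NumberTheory.Rogawski1990.LocalNormFibreMatchedCountCM                            -- ★ p842327 B-p04 (g34): `exists_nhds_matched_badFrame_count` = `hcnt`, `badBlock_herm_and_isUnit_det`; brings ★ `anisotropic_of_neg_det_not_norm`, ★ `not_exists_neg_det_badBlock_eq_norm`
import Literature.NumberTheory.Rogawski1990.FinExplicitTransferFactorBadFrameConstancy              -- ★ p842237 A-p16 (g26): `exists_const_nhds_finExplicitCollection_Δ_eq_of_frame` = `hΔ′`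
import Literature.NumberTheory.Rogawski1990.LocalTransferCompactSideJunctionCM                      -- ★ p842024 B-p08 (g27): the junction whose three residual binders `hD′ ∕ hΔ′ ∕ hcnt` are packaged here (statement vocabulary)
import Literature.NumberTheory.Rogawski1990.LocalNormFibreBadFrameClasses                           -- ★ p842136 p08 (g13): `frame_conj_mem_unitaryGroup`
import Literature.NumberTheory.Rogawski1990.LocalNormFibreBlockDichotomyDock                        -- ★ `coe_endoEmbLocal_eq_swap_mul_finSum_mul_swap` (`ι_v(h) = W (h.1 ⊕ᶠ h.2) W`)
import Literature.NumberTheory.Automorphic.OrbitalMeasureCanonicalExists                            -- ★ `OrbitalMeasureFamily.exists_isCanonical`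
import Literature.NumberTheory.Automorphic.CompactCoreCentralizerNonarch                            -- ★ `exists_isHaarMeasure_compactCore_eq_one`
import Literature.NumberTheory.Automorphic.ClosedCompactDecomposition                               -- ★ `isMulRightInvariant_of_compactSpace` (compact groups are unimodular)
import HarnessLib

/-!
# THE COMPACT-SIDE PACKAGE of the (S1) germ at `ε_H = (a·1₂, u)` ASSEMBLED at the concrete compact dock `C′ := Z_{G′_v}(ε′)`,
# `ε′ := P′·(a·1₂ ⊕ᶠ u)·P′⁻¹` the framed second class — `stub_N6nsS1pkg` of the line «N6nsGerm» PROVED OUTRIGHT from ★ (D2ε′)+(sat′), ★ (Δ-θ′), ★ (CNT)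

Topic `NumberTheory/Rogawski1990`; namespace `Literature.NumberTheory.Rogawski1990`.  THEOREMS ONLY (no definition, no instance, no notation, no named fact, no `sorry`).
Cell `pub/hodgecm-mathlib` (D-0151), crux H413 = stmt-HodgeConjecture-24833, floor-2 line «N6nsGerm» `Cruxes/H413/Lines/F0_P3a_N6nsGerm.lean`, stub `stub_N6nsS1pkg` (ED. 1.4,
pen F0P2-p02 (g8)); LEAD F0P3a-plan (g9) WORD T8-138 (c), pen «= FILE» 2026-09-01T07:26:27Z; seat A-p14 (g28).  HONEST LABEL: HC_CM is proved only modulo the printed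
citations until rung 0 closes; this file is ASSEMBLY over ★ bricks of A-p17 (g21), A-p16 (g26), B-p04 (g34), F0P3a-p08 (g13) — it pays no printed statement; it closes
`stub_N6nsS1pkg` with NO residual hypothesis (the stub's own ∀-prefix only).

THE MATHEMATICS.  At a non-split finite place `v` (one place `w ∣ v`) let `ε_H = (a·1₂, u) ∈ H_v = U(Φ₂)_v × U(Φ₁)_v` with `u ≠ a`, `θ : H_v ≃ Z_{G′_v}(ε)` the central dock
(`θ z = y·ι_v(z)·y⁻¹`, `θ ε_H = ε`) and `P′` a BAD frame on it: `ᵗ(σP′) H′_v P′ = G₁′ ⊕ᶠ G₂′` with `det G₁′ ∉ det G₁ · N(E_w^×)`, where `G₁ ⊕ᶠ G₂ = ᵗ(σ(yW)) H′_v (yW)` is the Gram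
matrix of the dock frame `yW` (`W` the transposition `(2 3)`, so that `(yW)⁻¹ ε (yW) = a·1₂ ⊕ᶠ u`).  The SECOND CLASS is the framed element `ε′ := P′·(a·1₂ ⊕ᶠ u)·P′⁻¹ ∈ G′_v`
(unitary because its blocks are norm-one scalars, ★ `frame_conj_mem_unitaryGroup`; `W ι_v(ε_H) W = a·1₂ ⊕ᶠ u` ★ `coe_endoEmbLocal_eq_swap_mul_finSum_mul_swap`).  The bad block
`G₁′` is hermitian with unit determinant (★ `badBlock_herm_and_isUnit_det`) and ANISOTROPIC: the dock gives `−det G₁ ∈ N(E_w^×)` and badness gives `−det G₁′ ∉ N(E_w^×)`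
(★ `not_exists_neg_det_badBlock_eq_norm`, ★ `anisotropic_of_neg_det_not_norm` — B-p04 (g34)); hence `C′ := Z(ε′) = P′·(U(G₁′) × U(G₂′))·P′⁻¹` is COMPACT (★ A-p17
`compactSpace_centralizer_of_frame_of_anisotropic`) [Rogawski1990 §8.2 pp. 117–122: the two classes `γ₀`, `γ₀′` through the scalar partner; §3.8 Prop. 3.8.1 (a)(d)].  On
the compact group `C′` take `ν′` = Haar (right-invariant: compact groups are unimodular, ★ `isMulRightInvariant_of_compactSpace`), `P″` = «regular in `GL₃`», and a canonical
orbital-measure family `m′` (★ `OrbitalMeasureFamily.exists_isCanonical`: centralisers of regular elements are commutative ★ `commute_of_commute_of_isRegularElt_local`, and on a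
compact group the compact core is everything, ★ `compactCore_eq_univ`, ★ `exists_isHaarMeasure_compactCore_eq_one`).  Then:
* (Δ-θ′) `hΔ′` — `Δ‴_v` is constant on the matched `P′`-framed classes near `ε_H` — is ★ A-p16 `exists_const_nhds_finExplicitCollection_Δ_eq_of_frame` BY NAME (any frame);
* (D2ε′)+(sat′) `hD′` — the descent of `Φ_G(·, ψ)` on the matched `P′`-framed classes to a locally constant `ψε` on `C′` — is ★ A-p17 (g21)
  `exists_isLocallyConstant_descent_secondClass` BY NAME at `(ε′, haar, P″, m′)`;
* (CNT) `hcnt` — finiteness and the count `#{matched P′-framed classes} = #{stable class of γ_H}` when `Z(γ_H.1)` is compact, emptiness otherwise — is ★ B-p04 (g34)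
  `exists_nhds_matched_badFrame_count` BY NAME (over ★ F0P3a-p08 (CNT-a) and ★ B-p04 (CNT-b)).
So `stub_N6nsS1pkg := exists_compactSidePackage_of_badFrame` (ED. 1.5∕1.6: one token).

* §1 private plumbing (norm-one scalar blocks are unitary for any Gram block, the swap `(2 3)` is an involution, `1 × 1` matrices are scalars; non-degeneracy of an
  anisotropic `H′`; the prime above a non-split `v` is conjugation-fixed).
* §2 HEAD **`exists_compactSidePackage_of_badFrame`** — statement = `stub_N6nsS1pkg`'s text VERBATIM (sliced from the pen's candidate 3d036a80 :131–:202 by script; no extra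
  hypothesis), i.e. `∀ (frame) (dock) (bad frame), ∃ C′ ‹12 instances› ν′ ‹2› P″ m′ ‹canonical› εC, hD′ ∧ hΔ′ ∧ hcnt`.

## References
* [Rogawski1990] J. D. Rogawski, *Automorphic Representations of Unitary Groups in Three Variables*, Ann. of Math. Stud. 123 (1990): §8.1 Prop. 8.1.3 pp. 110–111 (frames,
  blocks), §8.2 Prop. 8.2.1 (a)(d) pp. 112–122 (the two classes `γ₀`, `γ₀′` through the scalar partner; `e(γ₀) = 1`, `e(γ₀′) = −1`), §3.8 Prop. 3.8.1 (a)(d) pp. 27–30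
  (anisotropic unitary groups are compact), §4.3 (4.3.1) p. 43 (canonical measures).
* [LanglandsShelstad1990Descent] R. P. Langlands, D. Shelstad, *Descent for transfer factors*, The Grothendieck Festschrift II (1990), §2.4 (equisingular descent).
* [DeitmarEchterhoff2014] A. Deitmar, S. Echterhoff, *Principles of Harmonic Analysis*, 2nd ed. (2014), Thm. 1.5.3 (quotient measures), §1.3 (Haar measure on compact groups).
-/

set_option autoImplicit false

noncomputable section

open NumberField IsDedekindDomain MeasureTheory Measure Topology Filter Matrix
open Literature.NumberTheory.Automorphic Literature.NumberTheory.GaloisRepresentations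
open Literature.AlgebraicGeometry.ShimuraVarieties (unitaryGroup hermForm)
open scoped MatrixGroups

namespace Literature.NumberTheory.Rogawski1990

/-! ## §1 Plumbing -/

section Generic

variable {S : Type*} [CommRing S] {N₁ N₂ : ℕ}

/-- `ᵗ(σ(s•1)) · G · (s•1) = (σ s · s) • G`; in particular a norm-one scalar block is unitary for every Gram block. [folklore] -/
private theorem twistGram_smul_one₁₀ (σ : S →+* S) {n : ℕ} (G : Matrix (Fin n) (Fin n) S) {s : S} (hs : σ s * s = 1) :
    twistGram σ G (s • (1 : Matrix (Fin n) (Fin n) S)) = G := by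
  rw [twistGram_def, Matrix.smul_one_eq_diagonal, Matrix.diagonal_map (map_zero σ), Matrix.diagonal_transpose, ← Matrix.smul_one_eq_diagonal,
    ← Matrix.smul_one_eq_diagonal, Matrix.smul_mul, Matrix.one_mul, Matrix.mul_smul, Matrix.mul_one, smul_smul, mul_comm, hs, one_smul]

/-- The coordinate swap `2 ↔ 3` is an involution. [folklore] -/
private theorem swap_mul_swap₁₀ : !![(1 : S), 0, 0; 0, 0, 1; 0, 1, 0] * !![(1 : S), 0, 0; 0, 0, 1; 0, 1, 0] = 1 := by
  ext i j
  fin_cases i <;> fin_cases j <;> simp [Matrix.mul_apply, Fin.sum_univ_three]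

/-- A `1 × 1` matrix is the scalar `C₀₀`. [folklore] -/
private theorem fin_one_eq_smul_one₁₀ (C : Matrix (Fin 1) (Fin 1) S) : C = C 0 0 • (1 : Matrix (Fin 1) (Fin 1) S) := by
  ext i j
  fin_cases i; fin_cases j
  simp

end Generic

section CM

variable (L : Type) [Field L] [NumberField L] [IsCMField L]

/-- An anisotropic hermitian matrix is invertible (local copy of ★ `det_ne_zero_of_anisotropic`). [cite: Rogawski1990, §3.8 Prop. 3.8.1 (a) p. 27] -/
private theorem det_ne_zero_of_anisotropic₁₀ {H : Matrix (Fin 3) (Fin 3) L}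
    (hH0 : ∀ x : Fin 3 → L, hermForm (cmConjRingHom L) H x x = 0 → x = 0) : H.det ≠ 0 := by
  intro hdet
  obtain ⟨x, hx, hHx⟩ := Matrix.exists_mulVec_eq_zero_iff.mpr hdet
  refine hx (hH0 x ?_)
  rw [Literature.AlgebraicGeometry.ShimuraVarieties.hermForm, hHx, dotProduct_zero]

/-- At a place with ONE prime of `L` above it, that prime is fixed by complex conjugation (local copy of ★ `smul_eq_of_subsingleton_placesOver`).
[cite: CasselsFrohlichANT1967, Ch. VII Prop. 1.2 (ii)] -/
private theorem smul_eq_of_subsingleton_placesOver₁₀ {v : HeightOneSpectrum (𝓞 ↥(maximalRealSubfield L))}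
    (hv : Subsingleton (UnitaryGroup.PlacesOver L v)) (w : UnitaryGroup.PlacesOver L v) : IsCMField.complexConj L • w.1 = w.1 := by
  have hmem : (IsCMField.complexConj L • w.1).under (𝓞 ↥(maximalRealSubfield L)) = v := by
    rw [HeightOneSpectrum.under_algEquiv_smul]; exact w.2
  exact congrArg Subtype.val (Subsingleton.elim (⟨IsCMField.complexConj L • w.1, hmem⟩ : UnitaryGroup.PlacesOver L v) w)

end CM

/-! ## §2 The head -/

open scoped Classical in
/-- **THE COMPACT-SIDE PACKAGE AT THE BAD FRAME — `stub_N6nsS1pkg` of «N6nsGerm» (ED. 1.4) PROVED**: for the central `ε_H = (a·1₂, u)` (`u ≠ a`) at a non-split `v`, its dock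
`θ` and a bad frame `P′` on it, the compact dock `C′ := Z_{G′_v}(ε′)` at the framed second class `ε′ = P′(a·1₂ ⊕ᶠ u)P′⁻¹`, with Haar `ν′`, `P″ =` regular and a canonical family
`m′`, carries (D2ε′)+(sat′) (★ `exists_isLocallyConstant_descent_secondClass`), (Δ-θ′) (★ `exists_const_nhds_finExplicitCollection_Δ_eq_of_frame`) and (CNT) (★
`exists_nhds_matched_badFrame_count`).  Statement = the stub's text verbatim.  See the module docstring.
[cite: Rogawski1990, §8.2 Prop. 8.2.1 (a)(d) pp. 112–122; §8.1 Prop. 8.1.3 pp. 110–111; §3.8 Prop. 3.8.1 (a)(d) pp. 27–30] [cite: LanglandsShelstad1990Descent, §2.4] -/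
theorem exists_compactSidePackage_of_badFrame :
    ∀ (L : Type) [Field L] [NumberField L] [IsCMField L] (H' : Matrix (Fin 3) (Fin 3) L) (μ : HeckeCharacter L)
      [∀ v : HeightOneSpectrum (𝓞 ↥(maximalRealSubfield L)),
        MeasurableSpace ((UnitaryGroup.cmDatum L 2 (Matrix.of fun i j : Fin 2 => if i.val + j.val + 1 = 2 then (1 : L) else 0)).Local v ×
          (UnitaryGroup.cmDatum L 1 (Matrix.of fun i j : Fin 1 => if i.val + j.val + 1 = 1 then (1 : L) else 0)).Local v)]
      [∀ v : HeightOneSpectrum (𝓞 ↥(maximalRealSubfield L)),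
        BorelSpace ((UnitaryGroup.cmDatum L 2 (Matrix.of fun i j : Fin 2 => if i.val + j.val + 1 = 2 then (1 : L) else 0)).Local v ×
          (UnitaryGroup.cmDatum L 1 (Matrix.of fun i j : Fin 1 => if i.val + j.val + 1 = 1 then (1 : L) else 0)).Local v)]
      [∀ v : HeightOneSpectrum (𝓞 ↥(maximalRealSubfield L)), MeasurableSpace ((UnitaryGroup.cmDatum L 3 H').Local v)]
      [∀ v : HeightOneSpectrum (𝓞 ↥(maximalRealSubfield L)), BorelSpace ((UnitaryGroup.cmDatum L 3 H').Local v)]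
      (νH : ∀ v : HeightOneSpectrum (𝓞 ↥(maximalRealSubfield L)),
        Measure ((UnitaryGroup.cmDatum L 2 (Matrix.of fun i j : Fin 2 => if i.val + j.val + 1 = 2 then (1 : L) else 0)).Local v ×
          (UnitaryGroup.cmDatum L 1 (Matrix.of fun i j : Fin 1 => if i.val + j.val + 1 = 1 then (1 : L) else 0)).Local v))
      (νG : ∀ v : HeightOneSpectrum (𝓞 ↥(maximalRealSubfield L)), Measure ((UnitaryGroup.cmDatum L 3 H').Local v))
      [∀ v, (νH v).IsHaarMeasure] [∀ v, (νH v).IsMulRightInvariant] [∀ v, (νG v).IsHaarMeasure] [∀ v, (νG v).IsMulRightInvariant],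
      μ.IsUnitary →
      (∀ x : ideleGroup ↥(maximalRealSubfield L), μ (AdeleRing.ideleBaseChange (↥(maximalRealSubfield L)) L x) = quadraticHeckeCharCM L x) →
      (H'.map (cmConjRingHom L)).transpose = H' →
      (∀ x : Fin 3 → L, hermForm (cmConjRingHom L) H' x x = 0 → x = 0) →
      ∀ (v : HeightOneSpectrum (𝓞 ↥(maximalRealSubfield L))), Subsingleton (UnitaryGroup.PlacesOver L v) →
      ∀ [_iH : ∀ a : ((UnitaryGroup.cmDatum L 2 (Matrix.of fun i j : Fin 2 => if i.val + j.val + 1 = 2 then (1 : L) else 0)).Local v × (UnitaryGroup.cmDatum L 1 (Matrix.of fun i j : Fin 1 => if i.val + j.val + 1 = 1 then (1 : L) else 0)).Local v),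
          MeasurableSpace (((UnitaryGroup.cmDatum L 2 (Matrix.of fun i j : Fin 2 => if i.val + j.val + 1 = 2 then (1 : L) else 0)).Local v × (UnitaryGroup.cmDatum L 1 (Matrix.of fun i j : Fin 1 => if i.val + j.val + 1 = 1 then (1 : L) else 0)).Local v) ⧸
            Subgroup.centralizer ({a} : Set ((UnitaryGroup.cmDatum L 2 (Matrix.of fun i j : Fin 2 => if i.val + j.val + 1 = 2 then (1 : L) else 0)).Local v × (UnitaryGroup.cmDatum L 1 (Matrix.of fun i j : Fin 1 => if i.val + j.val + 1 = 1 then (1 : L) else 0)).Local v)))]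
        [_bH : ∀ a : ((UnitaryGroup.cmDatum L 2 (Matrix.of fun i j : Fin 2 => if i.val + j.val + 1 = 2 then (1 : L) else 0)).Local v × (UnitaryGroup.cmDatum L 1 (Matrix.of fun i j : Fin 1 => if i.val + j.val + 1 = 1 then (1 : L) else 0)).Local v),
          BorelSpace (((UnitaryGroup.cmDatum L 2 (Matrix.of fun i j : Fin 2 => if i.val + j.val + 1 = 2 then (1 : L) else 0)).Local v × (UnitaryGroup.cmDatum L 1 (Matrix.of fun i j : Fin 1 => if i.val + j.val + 1 = 1 then (1 : L) else 0)).Local v) ⧸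
            Subgroup.centralizer ({a} : Set ((UnitaryGroup.cmDatum L 2 (Matrix.of fun i j : Fin 2 => if i.val + j.val + 1 = 2 then (1 : L) else 0)).Local v × (UnitaryGroup.cmDatum L 1 (Matrix.of fun i j : Fin 1 => if i.val + j.val + 1 = 1 then (1 : L) else 0)).Local v)))]
        [_iG : ∀ γ : ((UnitaryGroup.cmDatum L 3 H').Local v), MeasurableSpace (((UnitaryGroup.cmDatum L 3 H').Local v) ⧸ Subgroup.centralizer ({γ} : Set ((UnitaryGroup.cmDatum L 3 H').Local v)))]
        [_bG : ∀ γ : ((UnitaryGroup.cmDatum L 3 H').Local v), BorelSpace (((UnitaryGroup.cmDatum L 3 H').Local v) ⧸ Subgroup.centralizer ({γ} : Set ((UnitaryGroup.cmDatum L 3 H').Local v)))]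
        (mH : OrbitalMeasureFamily ((UnitaryGroup.cmDatum L 2 (Matrix.of fun i j : Fin 2 => if i.val + j.val + 1 = 2 then (1 : L) else 0)).Local v × (UnitaryGroup.cmDatum L 1 (Matrix.of fun i j : Fin 1 => if i.val + j.val + 1 = 1 then (1 : L) else 0)).Local v))
        (mG : OrbitalMeasureFamily ((UnitaryGroup.cmDatum L 3 H').Local v)),
      mH.IsCanonical (IsLocalGRegular L v) (νH v) → mG.IsCanonical (fun γ => IsRegularElt (γ.val : GL (Fin 3) (UnitaryGroup.LocalRing L v))) (νG v) →
      ∀ (φ : ((UnitaryGroup.cmDatum L 3 H').Local v) → ℂ), IsLocSmooth φ →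
      ∀ (εH : ((UnitaryGroup.cmDatum L 2 (Matrix.of fun i j : Fin 2 => if i.val + j.val + 1 = 2 then (1 : L) else 0)).Local v × (UnitaryGroup.cmDatum L 1 (Matrix.of fun i j : Fin 1 => if i.val + j.val + 1 = 1 then (1 : L) else 0)).Local v)) (a : (UnitaryGroup.LocalRing L v)),
        (εH.1.val.val : Matrix (Fin 2) (Fin 2) (UnitaryGroup.LocalRing L v)) = a • (1 : Matrix (Fin 2) (Fin 2) (UnitaryGroup.LocalRing L v)) →
        (εH.2.val.val : Matrix (Fin 1) (Fin 1) (UnitaryGroup.LocalRing L v)) 0 0 ≠ a →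
        -- the central dock (★ `exists_centralDock_of_fst_eq_smul_one`)
        ∀ (ε : ((UnitaryGroup.cmDatum L 3 H').Local v)) (y : GL (Fin 3) (UnitaryGroup.LocalRing L v)) (θ : ((UnitaryGroup.cmDatum L 2 (Matrix.of fun i j : Fin 2 => if i.val + j.val + 1 = 2 then (1 : L) else 0)).Local v × (UnitaryGroup.cmDatum L 1 (Matrix.of fun i j : Fin 1 => if i.val + j.val + 1 = 1 then (1 : L) else 0)).Local v) ≃ₜ* ↥(Subgroup.centralizer ({ε} : Set ((UnitaryGroup.cmDatum L 3 H').Local v)))),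
        (θ εH).1 = ε →
        (∀ z : ((UnitaryGroup.cmDatum L 2 (Matrix.of fun i j : Fin 2 => if i.val + j.val + 1 = 2 then (1 : L) else 0)).Local v × (UnitaryGroup.cmDatum L 1 (Matrix.of fun i j : Fin 1 => if i.val + j.val + 1 = 1 then (1 : L) else 0)).Local v), (((θ z).1).val : GL (Fin 3) (UnitaryGroup.LocalRing L v)) = y * ((endoEmbLocal L v z).val : GL (Fin 3) (UnitaryGroup.LocalRing L v)) * y⁻¹) →
        -- the bad frame on the dock (★ `exists_badFrame_dock`)
        ∀ (W : GL (Fin 3) (UnitaryGroup.LocalRing L v)), W.val = !![(1 : UnitaryGroup.LocalRing L v), 0, 0; 0, 0, 1; 0, 1, 0] →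
        ∀ (G₁ G₁' : Matrix (Fin 2) (Fin 2) (UnitaryGroup.LocalRing L v)) (G₂ G₂' : Matrix (Fin 1) (Fin 1) (UnitaryGroup.LocalRing L v)) (P' : GL (Fin (2 + 1)) (UnitaryGroup.LocalRing L v)),
        twistGram (UnitaryGroup.conjLocal L (IsCMField.complexConj L) v) ((UnitaryGroup.adelicForm L 3 H').map (UnitaryGroup.adeleToLocal L v)) (y * W).val = UnitaryGroup.finSum 2 1 G₁ G₂ →
        twistGram (UnitaryGroup.conjLocal L (IsCMField.complexConj L) v) ((UnitaryGroup.adelicForm L 3 H').map (UnitaryGroup.adeleToLocal L v)) P'.val = UnitaryGroup.finSum 2 1 G₁' G₂' →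
        (¬ ∃ z : UnitaryGroup.LocalRing L v, IsUnit z ∧ G₁'.det = G₁.det * (UnitaryGroup.conjLocal L (IsCMField.complexConj L) v z * z)) →
        -- the compact-side package: an abstract compact dock `C′` carrying (D2ε′)+(sat′), (Δ-θ′), (CNT)
        ∃ (C' : Type) (_ : Group C') (_ : TopologicalSpace C') (_ : IsTopologicalGroup C') (_ : CompactSpace C') (_ : LocallyCompactSpace C')
          (_ : SecondCountableTopology C') (_ : T2Space C') (_ : MeasurableSpace C') (_ : BorelSpace C')
          (_ : ∀ m : C', MeasurableSpace (C' ⧸ Subgroup.centralizer ({m} : Set C'))) (_ : ∀ m : C', BorelSpace (C' ⧸ Subgroup.centralizer ({m} : Set C')))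
          (ν' : Measure C') (_ : ν'.IsHaarMeasure) (_ : ν'.IsMulRightInvariant) (P'' : C' → Prop) (m' : OrbitalMeasureFamily C') (_ : m'.IsCanonical P'' ν') (εC : C'),
        (∀ ψ : ((UnitaryGroup.cmDatum L 3 H').Local v) → ℂ, IsLocSmooth ψ → ∃ ψε : C' → ℂ, IsLocallyConstant ψε ∧ ∀ B' ∈ 𝓝 εC, ∃ V ∈ 𝓝 εH, ∀ γH ∈ V, IsLocalGRegular L v γH →
        ∀ c : ConjClasses ((UnitaryGroup.cmDatum L 3 H').Local v), (∃ x : ((UnitaryGroup.cmDatum L 3 H').Local v), (∃ B : Matrix (Fin 2) (Fin 2) (UnitaryGroup.LocalRing L v), ((x * Quotient.out c * x⁻¹).val.val : Matrix (Fin 3) (Fin 3) (UnitaryGroup.LocalRing L v)) * P'.val = P'.val * UnitaryGroup.finSum 2 1 B (γH.2.val.val : Matrix (Fin 1) (Fin 1) (UnitaryGroup.LocalRing L v)))) → IsLocalNormPair L H' v γH (Quotient.out c) →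
          ∃ m ∈ B', P'' (Quotient.out (ConjClasses.mk m)) ∧ classOrbitalIntegral mG ψ c = classOrbitalIntegral m' ψε (ConjClasses.mk m)) ∧
        (∃ Δ₁ : ℂ, ∃ VΔ ∈ 𝓝 εH, ∀ γH ∈ VΔ, IsLocalGRegular L v γH → ∀ c : ConjClasses ((UnitaryGroup.cmDatum L 3 H').Local v), (∃ x : ((UnitaryGroup.cmDatum L 3 H').Local v), (∃ B : Matrix (Fin 2) (Fin 2) (UnitaryGroup.LocalRing L v), ((x * Quotient.out c * x⁻¹).val.val : Matrix (Fin 3) (Fin 3) (UnitaryGroup.LocalRing L v)) * P'.val = P'.val * UnitaryGroup.finSum 2 1 B (γH.2.val.val : Matrix (Fin 1) (Fin 1) (UnitaryGroup.LocalRing L v)))) →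
        IsLocalNormPair L H' v γH (Quotient.out c) → ((finExplicitCollection L H' μ (finExplicitDelta_conj_left_all L H' μ) (finExplicitDelta_conj_right_all L H' μ)) v).Δ γH (Quotient.out c) = Δ₁) ∧
        (∃ Vc ∈ 𝓝 εH, ∀ γH ∈ Vc, IsLocalGRegular L v γH →
        {c : ConjClasses ((UnitaryGroup.cmDatum L 3 H').Local v) | (∃ x : ((UnitaryGroup.cmDatum L 3 H').Local v), (∃ B : Matrix (Fin 2) (Fin 2) (UnitaryGroup.LocalRing L v), ((x * Quotient.out c * x⁻¹).val.val : Matrix (Fin 3) (Fin 3) (UnitaryGroup.LocalRing L v)) * P'.val = P'.val * UnitaryGroup.finSum 2 1 B (γH.2.val.val : Matrix (Fin 1) (Fin 1) (UnitaryGroup.LocalRing L v)))) ∧ IsLocalNormPair L H' v γH (Quotient.out c)}.Finite ∧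
        {d : ConjClasses (((UnitaryGroup.cmDatum L 2 (Matrix.of fun i j : Fin 2 => if i.val + j.val + 1 = 2 then (1 : L) else 0)).Local v) ×
      ((UnitaryGroup.cmDatum L 1 (Matrix.of fun i j : Fin 1 => if i.val + j.val + 1 = 1 then (1 : L) else 0)).Local v)) | IsLocalStablyConjH L v γH (Quotient.out d)}.Finite ∧
        (CompactSpace (Subgroup.centralizer ({γH.1} : Set ((UnitaryGroup.cmDatum L 2 (Matrix.of fun i j : Fin 2 => if i.val + j.val + 1 = 2 then (1 : L) else 0)).Local v))) →
          {c : ConjClasses ((UnitaryGroup.cmDatum L 3 H').Local v) | (∃ x : ((UnitaryGroup.cmDatum L 3 H').Local v), (∃ B : Matrix (Fin 2) (Fin 2) (UnitaryGroup.LocalRing L v), ((x * Quotient.out c * x⁻¹).val.val : Matrix (Fin 3) (Fin 3) (UnitaryGroup.LocalRing L v)) * P'.val = P'.val * UnitaryGroup.finSum 2 1 B (γH.2.val.val : Matrix (Fin 1) (Fin 1) (UnitaryGroup.LocalRing L v)))) ∧ IsLocalNormPair L H' v γH (Quotient.out c)}.ncard =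
            {d : ConjClasses (((UnitaryGroup.cmDatum L 2 (Matrix.of fun i j : Fin 2 => if i.val + j.val + 1 = 2 then (1 : L) else 0)).Local v) ×
      ((UnitaryGroup.cmDatum L 1 (Matrix.of fun i j : Fin 1 => if i.val + j.val + 1 = 1 then (1 : L) else 0)).Local v)) | IsLocalStablyConjH L v γH (Quotient.out d)}.ncard) ∧
        (¬ CompactSpace (Subgroup.centralizer ({γH.1} : Set ((UnitaryGroup.cmDatum L 2 (Matrix.of fun i j : Fin 2 => if i.val + j.val + 1 = 2 then (1 : L) else 0)).Local v))) →
          ∀ c : ConjClasses ((UnitaryGroup.cmDatum L 3 H').Local v), (∃ x : ((UnitaryGroup.cmDatum L 3 H').Local v), (∃ B : Matrix (Fin 2) (Fin 2) (UnitaryGroup.LocalRing L v), ((x * Quotient.out c * x⁻¹).val.val : Matrix (Fin 3) (Fin 3) (UnitaryGroup.LocalRing L v)) * P'.val = P'.val * UnitaryGroup.finSum 2 1 B (γH.2.val.val : Matrix (Fin 1) (Fin 1) (UnitaryGroup.LocalRing L v)))) → ¬ IsLocalNormPair L H' v γH (Quotient.out c))) := by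
  intro L _ _ _ H' μ _ _ _ _ νH νG _ _ _ _ hμu hμω hherm hanis v hv _iH _bH _iG _bG mH mG hmH hmG φ hφ εH a ha hu ε y θ hθε hθ W hW G₁ G₁' G₂ G₂' P'
    hPW hP' hnn
  classical
  obtain ⟨w⟩ := (inferInstance : Nonempty (UnitaryGroup.PlacesOver L v))
  have hw : IsCMField.complexConj L • w.1 = w.1 := smul_eq_of_subsingleton_placesOver₁₀ L hv w
  have hdet' : H'.det ≠ 0 := det_ne_zero_of_anisotropic₁₀ L hanis
  have hHd : IsUnit ((UnitaryGroup.adelicForm L 3 H').map (UnitaryGroup.adeleToLocal L v)).det := UnitaryGroup.isUnit_det_localForm L 3 H' v hdet'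
  have ha1 : (UnitaryGroup.conjLocal L (IsCMField.complexConj L) v) a * a = 1 := conjLocal_mul_self_of_fst_eq_smul_one L v εH ha
  have hu1 : (UnitaryGroup.conjLocal L (IsCMField.complexConj L) v) (finGammaTwo L v εH) * finGammaTwo L v εH = 1 := conjLocal_finGammaTwo_mul_finGammaTwo L v εH
  have h2u : (εH.2.val.val : Matrix (Fin 1) (Fin 1) (UnitaryGroup.LocalRing L v)) = finGammaTwo L v εH • (1 : Matrix (Fin 1) (Fin 1) (UnitaryGroup.LocalRing L v)) :=
    fin_one_eq_smul_one₁₀ _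
  have hau : IsUnit (a - finGammaTwo L v εH) := isUnit_localRing_of_ne_zero_of_subsingleton L v hv (sub_ne_zero.2 (Ne.symm hu))
  -- (1) the framed second class `ε′ := P′ · T · P′⁻¹` with `T := W ι_v(ε_H) W`, `T = a•1₂ ⊕ᶠ u`
  obtain ⟨T, hT⟩ : ∃ T : GL (Fin (2 + 1)) (UnitaryGroup.LocalRing L v), T = W * ((endoEmbLocal L v εH).val : GL (Fin 3) (UnitaryGroup.LocalRing L v)) * W := ⟨_, rfl⟩
  have hTval : T.val = (UnitaryGroup.finSum 2 1 (a • (1 : Matrix (Fin 2) (Fin 2) (UnitaryGroup.LocalRing L v))) (εH.2.val.val : Matrix (Fin 1) (Fin 1) (UnitaryGroup.LocalRing L v))) := by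
    rw [hT, Units.val_mul, Units.val_mul, hW, coe_endoEmbLocal_eq_swap_mul_finSum_mul_swap, ha]
    rw [← Matrix.mul_assoc, ← Matrix.mul_assoc, swap_mul_swap₁₀, Matrix.one_mul, Matrix.mul_assoc, swap_mul_swap₁₀, Matrix.mul_one]
  have hB1 : twistGram (UnitaryGroup.conjLocal L (IsCMField.complexConj L) v) G₁' (a • (1 : Matrix (Fin 2) (Fin 2) (UnitaryGroup.LocalRing L v))) = G₁' := twistGram_smul_one₁₀ _ G₁' ha1
  have hC1 : twistGram (UnitaryGroup.conjLocal L (IsCMField.complexConj L) v) G₂' (εH.2.val.val : Matrix (Fin 1) (Fin 1) (UnitaryGroup.LocalRing L v)) = G₂' := by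
    rw [h2u]; exact twistGram_smul_one₁₀ _ G₂' hu1
  have hmem : P' * T * P'⁻¹ ∈ unitaryGroup (UnitaryGroup.conjLocal L (IsCMField.complexConj L) v) ((UnitaryGroup.adelicForm L 3 H').map (UnitaryGroup.adeleToLocal L v)) := frame_conj_mem_unitaryGroup (UnitaryGroup.conjLocal L (IsCMField.complexConj L) v) (N₁ := 2) (N₂ := 1) _ hP' hTval hB1 hC1
  obtain ⟨ε', hε'val⟩ : ∃ ε' : ((UnitaryGroup.cmDatum L 3 H').Local v), (ε'.val : GL (Fin 3) (UnitaryGroup.LocalRing L v)) = P' * T * P'⁻¹ := ⟨⟨P' * T * P'⁻¹, hmem⟩, rfl⟩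
  have hε'P : (ε'.val.val : Matrix (Fin 3) (Fin 3) (UnitaryGroup.LocalRing L v)) * P'.val = P'.val * (UnitaryGroup.finSum 2 1 (a • (1 : Matrix (Fin 2) (Fin 2) (UnitaryGroup.LocalRing L v))) (εH.2.val.val : Matrix (Fin 1) (Fin 1) (UnitaryGroup.LocalRing L v))) := by
    rw [← hTval, hε'val, ← Units.val_mul, ← Units.val_mul, inv_mul_cancel_right]
  have hε'D : (ε'.val.val : Matrix (Fin 3) (Fin 3) (UnitaryGroup.LocalRing L v)) * P'.val = P'.val * (UnitaryGroup.finSum 2 1 (a • (1 : Matrix (Fin 2) (Fin 2) (UnitaryGroup.LocalRing L v))) (finGammaTwo L v εH • (1 : Matrix (Fin 1) (Fin 1) (UnitaryGroup.LocalRing L v)))) := by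
    rw [← h2u]; exact hε'P
  -- (2) the bad block is hermitian, non-degenerate and ANISOTROPIC (★ B-p04); the corner `G₂′` is a unit; so `C′ := Z(ε′)` is COMPACT (★ A-p17)
  obtain ⟨hG₁', hG₁'d⟩ := badBlock_herm_and_isUnit_det L H' v hherm hdet' hP'
  have hanis' : ∀ x : Fin 2 → (UnitaryGroup.LocalRing L v), hermForm (UnitaryGroup.conjLocal L (IsCMField.complexConj L) v) G₁' x x = 0 → x = 0 :=
    anisotropic_of_neg_det_not_norm L v w hw hG₁' hG₁'d (not_exists_neg_det_badBlock_eq_norm L H' v w hw hherm hdet' θ hθ hW hPW hnn)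
  have hG₂'u : IsUnit (G₂' 0 0) := by
    have hd' : G₁'.det * G₂' 0 0 = (UnitaryGroup.conjLocal L (IsCMField.complexConj L) v) P'.val.det * ((UnitaryGroup.adelicForm L 3 H').map (UnitaryGroup.adeleToLocal L v)).det * P'.val.det := by
      rw [← Matrix.det_fin_one G₂', ← UnitaryGroup.det_finSum, ← hP', det_twistGram]
    refine isUnit_of_mul_isUnit_right (?_ : IsUnit (G₁'.det * G₂' 0 0))
    rw [hd']
    exact (((Matrix.isUnits_det_units P').map _).mul hHd).mul (Matrix.isUnits_det_units P')
  haveI hC : CompactSpace ↥(Subgroup.centralizer ({ε'} : Set ((UnitaryGroup.cmDatum L 3 H').Local v))) := compactSpace_centralizer_of_frame_of_anisotropic L v H' ε' w hw hau hε'D hP' hanis' hG₂'u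
  -- (3) the carrier data on `C′ := Z(ε′)`: Borel σ-algebras, local compactness, Haar `ν′` (right-invariant on a compact group), `P″ :=` regular
  letI iC : MeasurableSpace ↥(Subgroup.centralizer ({ε'} : Set ((UnitaryGroup.cmDatum L 3 H').Local v))) := borel _
  haveI bC : BorelSpace ↥(Subgroup.centralizer ({ε'} : Set ((UnitaryGroup.cmDatum L 3 H').Local v))) := ⟨rfl⟩
  letI iCq : ∀ m : ↥(Subgroup.centralizer ({ε'} : Set ((UnitaryGroup.cmDatum L 3 H').Local v))), MeasurableSpace (↥(Subgroup.centralizer ({ε'} : Set ((UnitaryGroup.cmDatum L 3 H').Local v))) ⧸ Subgroup.centralizer ({m} : Set ↥(Subgroup.centralizer ({ε'} : Set ((UnitaryGroup.cmDatum L 3 H').Local v))))) := fun _ => borel _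
  haveI bCq : ∀ m : ↥(Subgroup.centralizer ({ε'} : Set ((UnitaryGroup.cmDatum L 3 H').Local v))), BorelSpace (↥(Subgroup.centralizer ({ε'} : Set ((UnitaryGroup.cmDatum L 3 H').Local v))) ⧸ Subgroup.centralizer ({m} : Set ↥(Subgroup.centralizer ({ε'} : Set ((UnitaryGroup.cmDatum L 3 H').Local v))))) := fun _ => ⟨rfl⟩
  haveI : LocallyCompactSpace ↥(Subgroup.centralizer ({ε'} : Set ((UnitaryGroup.cmDatum L 3 H').Local v))) := (isClosed_coe_centralizer_singleton ε').isClosedEmbedding_subtypeVal.locallyCompactSpace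
  haveI hνr : (Measure.haar : Measure ↥(Subgroup.centralizer ({ε'} : Set ((UnitaryGroup.cmDatum L 3 H').Local v)))).IsMulRightInvariant := isMulRightInvariant_of_compactSpace _
  obtain ⟨P'', hP''⟩ : ∃ P'' : ↥(Subgroup.centralizer ({ε'} : Set ((UnitaryGroup.cmDatum L 3 H').Local v))) → Prop, P'' = fun m : ↥(Subgroup.centralizer ({ε'} : Set ((UnitaryGroup.cmDatum L 3 H').Local v))) => IsRegularElt ((m.1.val : GL (Fin 3) (UnitaryGroup.LocalRing L v))) := ⟨_, rfl⟩
  have hP''reg : ∀ m : ↥(Subgroup.centralizer ({ε'} : Set ((UnitaryGroup.cmDatum L 3 H').Local v))), IsRegularElt ((m.1.val : GL (Fin 3) (UnitaryGroup.LocalRing L v))) → P'' m := fun m h => by rw [hP'']; exact h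
  -- (4) a canonical orbital-measure family on the compact group `C′` (centralisers of regular elements are commutative; the compact core is everything)
  have ht : ∀ m : ↥(Subgroup.centralizer ({ε'} : Set ((UnitaryGroup.cmDatum L 3 H').Local v))), P'' m →
      ∃ t : Measure ↥(Subgroup.centralizer ({m} : Set ↥(Subgroup.centralizer ({ε'} : Set ((UnitaryGroup.cmDatum L 3 H').Local v))))), t.IsHaarMeasure ∧ t.IsInvInvariant ∧ t (compactCore ↥(Subgroup.centralizer ({m} : Set ↥(Subgroup.centralizer ({ε'} : Set ((UnitaryGroup.cmDatum L 3 H').Local v)))))) = 1 := by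
    intro m hm
    rw [hP''] at hm
    haveI : CompactSpace ↥(Subgroup.centralizer ({m} : Set ↥(Subgroup.centralizer ({ε'} : Set ((UnitaryGroup.cmDatum L 3 H').Local v))))) :=
      isCompact_iff_compactSpace.mp (isClosed_coe_centralizer_singleton m).isCompact
    haveI : LocallyCompactSpace ↥(Subgroup.centralizer ({m} : Set ↥(Subgroup.centralizer ({ε'} : Set ((UnitaryGroup.cmDatum L 3 H').Local v))))) :=
      (isClosed_coe_centralizer_singleton m).isClosedEmbedding_subtypeVal.locallyCompactSpace
    have hcomm : ∀ p q : ↥(Subgroup.centralizer ({m} : Set ↥(Subgroup.centralizer ({ε'} : Set ((UnitaryGroup.cmDatum L 3 H').Local v))))), p * q = q * p := by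
      intro p q
      have hp := Subgroup.mem_centralizer_singleton_iff.mp p.2
      have hq := Subgroup.mem_centralizer_singleton_iff.mp q.2
      have hp' : Commute ((p.1.1.val : GL (Fin 3) (UnitaryGroup.LocalRing L v)).val) ((m.1.val : GL (Fin 3) (UnitaryGroup.LocalRing L v)).val) := by
        have := congrArg (fun z : ↥(Subgroup.centralizer ({ε'} : Set ((UnitaryGroup.cmDatum L 3 H').Local v))) => ((z.1.val : GL (Fin 3) (UnitaryGroup.LocalRing L v)).val : Matrix (Fin 3) (Fin 3) (UnitaryGroup.LocalRing L v))) hp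
        exact this
      have hq' : Commute ((q.1.1.val : GL (Fin 3) (UnitaryGroup.LocalRing L v)).val) ((m.1.val : GL (Fin 3) (UnitaryGroup.LocalRing L v)).val) := by
        have := congrArg (fun z : ↥(Subgroup.centralizer ({ε'} : Set ((UnitaryGroup.cmDatum L 3 H').Local v))) => ((z.1.val : GL (Fin 3) (UnitaryGroup.LocalRing L v)).val : Matrix (Fin 3) (Fin 3) (UnitaryGroup.LocalRing L v))) hq
        exact this
      have hc := UnitaryGroup.commute_of_commute_of_isRegularElt_local L v m.1 hm _ _ hp' hq'
      apply Subtype.ext; apply Subtype.ext; apply Subtype.ext; apply Units.ext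
      exact hc.eq
    have hcc : compactCore ↥(Subgroup.centralizer ({m} : Set ↥(Subgroup.centralizer ({ε'} : Set ((UnitaryGroup.cmDatum L 3 H').Local v))))) = Set.univ := compactCore_eq_univ _
    obtain ⟨t, ht1, ht2, ht3⟩ := exists_isHaarMeasure_compactCore_eq_one hcomm (by rw [hcc]; exact isCompact_univ) (by rw [hcc]; exact isOpen_univ)
    exact ⟨t, ht1, ht2, ht3⟩
  obtain ⟨m', hm'⟩ := OrbitalMeasureFamily.exists_isCanonical P'' (Measure.haar : Measure ↥(Subgroup.centralizer ({ε'} : Set ((UnitaryGroup.cmDatum L 3 H').Local v)))) ht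
  -- (5) assemble: (D2ε′)+(sat′) ★ A-p17, (Δ-θ′) ★ A-p16, (CNT) ★ B-p04 — BY NAME
  exact ⟨↥(Subgroup.centralizer ({ε'} : Set ((UnitaryGroup.cmDatum L 3 H').Local v))), inferInstance, inferInstance, inferInstance, hC, inferInstance, inferInstance, inferInstance, iC, bC, iCq, bCq,
    (Measure.haar : Measure ↥(Subgroup.centralizer ({ε'} : Set ((UnitaryGroup.cmDatum L 3 H').Local v)))), inferInstance, hνr, P'', m', hm', ⟨ε', Subgroup.mem_centralizer_singleton_iff.mpr rfl⟩,
    exists_isLocallyConstant_descent_secondClass L H' v hherm hdet' w hw (νG v) hmG εH a ha hu hP' hanis' ε' hε'P (Measure.haar : Measure ↥(Subgroup.centralizer ({ε'} : Set ((UnitaryGroup.cmDatum L 3 H').Local v)))) P'' hP''reg hm',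
    exists_const_nhds_finExplicitCollection_Δ_eq_of_frame L H' v w hw μ εH a ha hu P',
    exists_nhds_matched_badFrame_count L H' v w hw hherm hdet' εH θ hθ hW hPW hP' hnn⟩

end Literature.NumberTheory.Rogawski1990

end
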